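import Summits.Parity.GeneralizedHardyLittlewood.Theses.ScaleTauberianCarving

/-!
# Route `ScaleTauberianCarving` — the `[assembly]` item (stmt-Parity-31403)

decomp-parity node G1.2.T «ScaleTauberianCarving» (lens-6 g6; critic CLEARED HOME/STATUS.md l.316, CRITIC-LEDGER
row 63; route born rev 0, commit 71d4b4a7eaf4): the assembly
`BoundedSiegelZeroQuality → UniformUpperGivenFixed → UniformLowerGivenFixed → LogWindowHL → ScaleRigidity →
UpperGlue → LowerGlue → GeneralizedHardyLittlewood` is literally the route's gate-written deciding theorem
`closes` (D-0027 §2.1), curried.  Hand by the cell's prover-class seat; no mathematics beyond the route file.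
-/

namespace Summit.Parity.GeneralizedHardyLittlewood.Theses.ScaleTauberianCarving

/-- **The `[assembly]` item holds** (stmt-Parity-31403): the seven route items imply
`GeneralizedHardyLittlewood`, by the route's deciding theorem `closes`. -/
theorem assembly_proof : Assembly :=
  fun hQ hUU hUL hA hB hGU hGL => closes hQ hUU hUL hA hB hGU hGL

end Summit.Parity.GeneralizedHardyLittlewood.Theses.ScaleTauberianCarving
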